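import Mathlib
import Summits.ResolutionOfSingularities.ResolutionOfSingularities.Theorems.CleanModels.Negative.CossartPiltant2019Thm15iFrameOrdTowerCurveChart
import Literature.RingTheory.Localization.DerivationFractionField
import HarnessLib

/-!
# Towards `CurveBlowupFacts 5`: the partial derivatives of `K = 𝔽_p(X₀,X₁,X₂)` and the order valuation

Support file (INPUTS seat res-inputs-p-cp15frame g2, 2026-08-28) for the residual hypothesis `CurveBlowupFacts 5` of
`CossartPiltant2019_thm_1_5_i_frame_false_of_curveBlowupFacts` (RETIRED statement F-110, crux `CleanModels`,
stmt-ResolutionOfSingularities-15917).  Clause (b) of `CurveBlowupFacts` (residues of a curve blow-up `B♯` that are `p`-th powers in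
`κ(ord_𝔪)` are `p`-th powers in `κ(B♯)`) is proved with DERIVATIONS; this file provides them:

* `OrdWitness.pd b : Derivation (ZMod p) K K` — `∂/∂X_b` extended to the fraction field (tree `Derivation.fractionFieldExtend`);
* `OrdWitness.ordVK_pd_le` — **`ord (∂h) ≥ ord h − 1`** (`exp(−1) · ordVK (∂h) ≤ ordVK h`): on polynomials `∂` lowers the `(X)`-adic
  order by at most one (`pderiv_mem_origin_pow`), and the quotient rule;
* `OrdWitness.pd_mem_range` — `∂` preserves `R = range (S → K)`;
* `OrdWitness.mem_sq_of_ordVK_pd_lt_one` — **INJECTIVITY OF THE GRADIENT on `𝔪_R/𝔪_R²`**: an `s ∈ 𝔪_R` all of whose partial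
  derivatives lie in `𝔪_R` lies in `𝔪_R²` (a polynomial without constant and linear terms has order `≥ 2`);
* `OrdWitness.exists_ordVK_wronskian_eq` — for a regular system of parameters `(u₀, v, w)` of `R`, **some Wronskian
  `u₀ ∂_b v − v ∂_b u₀` has order exactly `1`** (equivalently: the residue of `v/u₀` in `κ(ord_𝔪)` is not a `p`-th power / is moved
  by some derivation): otherwise `v − λu₀ ∈ 𝔪²` for `λ = ∂_{b₀}v/∂_{b₀}u₀`, contradicting the minimality of the system.

Nothing here proves or refutes resolution of singularities in characteristic `p`; [OURS · NEGATIVE-SUPPORT] counted 0.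
-/

noncomputable section

set_option linter.dupNamespace false -- mandated namespace of this single-conjunct summit

open MvPolynomial IsLocalRing
open Literature.AlgebraicGeometry.Resolution Literature.AlgebraicGeometry.Resolution.WeightedBlowup

namespace Summit.ResolutionOfSingularities.ResolutionOfSingularities.Theorems.CleanModels.Negative

namespace OrdWitness

variable (p : ℕ) [hp : Fact p.Prime]

/-! ## 1. The partial derivatives on `K` -/

/-- **`∂/∂X_b` on `K = Frac 𝔽_p[X₀,X₁,X₂]`** (the unique extension of `pderiv b`). [folklore] -/
def pd (b : Fin 3) : Derivation (ZMod p) (K p) (K p) :=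
  Derivation.fractionFieldExtend (A := Poly p) (F := K p)
    (LinearMap.compDer (Algebra.linearMap (Poly p) (K p)) (pderiv b))

/-- `∂_b` extends `pderiv b`. [folklore] -/
theorem pd_algebraMap (b : Fin 3) (a : Poly p) :
    pd p b (algebraMap (Poly p) (K p) a) = algebraMap (Poly p) (K p) (pderiv b a) := by
  rw [pd, Derivation.fractionFieldExtend_algebraMap]
  rfl

/-- `∂_b` kills `p`-th powers (characteristic `p`). [folklore] -/
theorem pd_pow_p (b : Fin 3) (d : K p) : pd p b (d ^ p) = 0 := by
  haveI := charP_K p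
  rw [Derivation.leibniz_pow, ← Nat.cast_smul_eq_nsmul (K p), CharP.cast_eq_zero (K p) p, zero_smul]

/-! ## 2. `∂_b` lowers the order by at most one -/

/-- On polynomials, `∂_b` maps `(X)ⁿ⁺¹` into `(X)ⁿ`. [folklore] -/
theorem pderiv_mem_origin_pow (b : Fin 3) {a : Poly p} {n : ℕ} (ha : a ∈ origin p ^ (n + 1)) :
    pderiv b a ∈ origin p ^ n := by
  rw [origin_eq_idealOfVars, MvPolynomial.mem_pow_idealOfVars_iff] at ha ⊢
  intro m hm
  rw [mem_support_iff, coeff_pderiv] at hm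
  have h1 : coeff (m + Finsupp.single b 1) a ≠ 0 := fun h => hm (by rw [h, zero_mul])
  have h2 := ha _ (mem_support_iff.mpr h1)
  rw [map_add, Finsupp.degree_single] at h2
  omega

/-- `exp(−1) · ordV (∂_b a) ≤ ordV a` for polynomials. [folklore] -/
theorem ordV_pderiv_le (b : Fin 3) (a : Poly p) : expNeg 1 * ordV p (pderiv b a) ≤ ordV p a := by
  by_cases hd : pderiv b a = 0
  · rw [hd, map_zero, mul_zero]; exact zero_le
  have ha : a ≠ 0 := by rintro rfl; exact hd (map_zero _)
  obtain ⟨N, hN⟩ := ENat.ne_top_iff_exists.mp (ord_ne_top p ha)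
  rcases Nat.eq_zero_or_pos N with hN0 | hNpos
  · subst hN0
    rw [ordV_eq_expNeg p ha hN.symm, expNeg_zero]
    calc expNeg 1 * ordV p (pderiv b a) ≤ 1 * 1 := mul_le_mul' (expNeg_le_one 1) (ordV_le_one p _)
      _ = 1 := one_mul _
  · obtain ⟨n, rfl⟩ : ∃ n, N = n + 1 := ⟨N - 1, by omega⟩
    rw [ordV_eq_expNeg p ha hN.symm]
    have haN : a ∈ origin p ^ (n + 1) := (ordV_le_expNeg_iff p ha (n + 1)).mp (by rw [ordV_eq_expNeg p ha hN.symm])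
    have h2 : ordV p (pderiv b a) ≤ expNeg n := (ordV_le_expNeg_iff p hd n).mpr (pderiv_mem_origin_pow p b haN)
    calc expNeg 1 * ordV p (pderiv b a) ≤ expNeg 1 * expNeg n := mul_le_mul' le_rfl h2
      _ = expNeg (n + 1) := by rw [← expNeg_add, add_comm]

/-- **`ord (∂_b h) ≥ ord h − 1` on `K`**: `exp(−1) · ordVK (∂_b h) ≤ ordVK h` (quotient rule). [folklore] -/
theorem ordVK_pd_le (b : Fin 3) (h : K p) : expNeg 1 * ordVK p (pd p b h) ≤ ordVK p h := by
  obtain ⟨a, s, hs, rfl⟩ := IsFractionRing.div_surjective (A := Poly p) h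
  have hs0 : (s : Poly p) ≠ 0 := nonZeroDivisors.ne_zero hs
  set A := algebraMap (Poly p) (K p) a with hA
  set T := algebraMap (Poly p) (K p) s with hT
  have hT0 : T ≠ 0 := (map_ne_zero_iff _ (IsFractionRing.injective (Poly p) (K p))).mpr hs0
  have hvT : ordVK p T ≠ 0 := (Valuation.ne_zero_iff _).mpr hT0
  have hDA : expNeg 1 * ordVK p (pd p b A) ≤ ordVK p A := by
    rw [hA, pd_algebraMap, ordVK_algebraMap, ordVK_algebraMap]; exact ordV_pderiv_le p b a
  have hDT : expNeg 1 * ordVK p (pd p b T) ≤ ordVK p T := by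
    rw [hT, pd_algebraMap, ordVK_algebraMap, ordVK_algebraMap]; exact ordV_pderiv_le p b s
  rw [Derivation.leibniz_div]
  simp only [smul_eq_mul, map_mul, map_pow, map_inv₀, map_div₀]
  have key : expNeg 1 * ordVK p (T * pd p b A - A * pd p b T) ≤ ordVK p T * ordVK p A := by
    have hsub := Valuation.map_sub (ordVK p) (T * pd p b A) (A * pd p b T)
    rw [map_mul, map_mul] at hsub
    rcases le_total (ordVK p T * ordVK p (pd p b A)) (ordVK p A * ordVK p (pd p b T)) with hle | hle
    · rw [max_eq_right hle] at hsub
      calc expNeg 1 * ordVK p (T * pd p b A - A * pd p b T) ≤ expNeg 1 * (ordVK p A * ordVK p (pd p b T)) :=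
            mul_le_mul' le_rfl hsub
        _ = ordVK p A * (expNeg 1 * ordVK p (pd p b T)) := by ac_rfl
        _ ≤ ordVK p A * ordVK p T := mul_le_mul' le_rfl hDT
        _ = ordVK p T * ordVK p A := mul_comm _ _
    · rw [max_eq_left hle] at hsub
      calc expNeg 1 * ordVK p (T * pd p b A - A * pd p b T) ≤ expNeg 1 * (ordVK p T * ordVK p (pd p b A)) :=
            mul_le_mul' le_rfl hsub
        _ = ordVK p T * (expNeg 1 * ordVK p (pd p b A)) := by ac_rfl
        _ ≤ ordVK p T * ordVK p A := mul_le_mul' le_rfl hDA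
  calc expNeg 1 * ((ordVK p T)⁻¹ ^ 2 * ordVK p (T * pd p b A - A * pd p b T))
      = (ordVK p T)⁻¹ ^ 2 * (expNeg 1 * ordVK p (T * pd p b A - A * pd p b T)) := by ac_rfl
    _ ≤ (ordVK p T)⁻¹ ^ 2 * (ordVK p T * ordVK p A) := mul_le_mul' le_rfl key
    _ = ordVK p A / ordVK p T := by
        rw [pow_two, div_eq_mul_inv, mul_assoc, ← mul_assoc (ordVK p T)⁻¹ (ordVK p T), inv_mul_cancel₀ hvT, one_mul,
          mul_comm]

/-- A multiplier of order `1` compensates: `ordVK (ℓ · ∂_b h) ≤ ordVK h` when `ordVK ℓ = exp (−1)`. [folklore] -/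
theorem ordVK_mul_pd_le (b : Fin 3) {ℓ : K p} (hℓ : ordVK p ℓ = expNeg 1) (h : K p) :
    ordVK p (ℓ * pd p b h) ≤ ordVK p h := by
  rw [map_mul, hℓ]; exact ordVK_pd_le p b h

/-! ## 3. `∂_b` preserves `R = range (S → K)` -/

/-- Polynomials lie in `R`. [folklore] -/
theorem algebraMap_mem_range (a : Poly p) : algebraMap (Poly p) (K p) a ∈ Rg p := by
  rw [← coe_toRange]; exact (toRange p a).2

/-- The inverse of a polynomial with nonzero constant term lies in `R`. [folklore] -/
theorem inv_algebraMap_mem_range {t : Poly p} (ht : t ∉ origin p) : (algebraMap (Poly p) (K p) t)⁻¹ ∈ Rg p := by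
  refine ⟨IsLocalization.mk' (S p) 1 (⟨t, ht⟩ : (origin p).primeCompl), ?_⟩
  have h1 := algebraMap_mk'_mul p 1 (⟨t, ht⟩ : (origin p).primeCompl)
  rw [map_one] at h1
  exact eq_inv_of_mul_eq_one_left h1

/-- Every element of `R` is `a/t` with `t(0) ≠ 0`. [folklore] -/
theorem exists_eq_div_of_mem_range {s : K p} (hs : s ∈ Rg p) :
    ∃ (a t : Poly p), t ∉ origin p ∧ algebraMap (Poly p) (K p) t ≠ 0 ∧
      s = algebraMap (Poly p) (K p) a / algebraMap (Poly p) (K p) t := by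
  obtain ⟨s', rfl⟩ := hs
  obtain ⟨⟨a, t⟩, rfl⟩ := IsLocalization.mk'_surjective (origin p).primeCompl s'
  have ht0 : algebraMap (Poly p) (K p) t ≠ 0 := by
    intro e
    have := ordVK_algebraMap p (t : Poly p)
    rw [e, map_zero, ordV_eq_one_of_not_mem p t.2] at this
    exact zero_ne_one this
  exact ⟨a, t, t.2, ht0, by rw [eq_div_iff ht0, algebraMap_mk'_mul]⟩

/-- **`∂_b R ⊆ R`** (quotient rule; `1/t ∈ R`). [folklore] -/
theorem pd_mem_range (b : Fin 3) {s : K p} (hs : s ∈ Rg p) : pd p b s ∈ Rg p := by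
  obtain ⟨a, t, ht, ht0, rfl⟩ := exists_eq_div_of_mem_range p hs
  rw [Derivation.leibniz_div, pd_algebraMap, pd_algebraMap]
  simp only [smul_eq_mul]
  exact Subring.mul_mem _ (Subring.pow_mem _ (inv_algebraMap_mem_range p ht) 2)
    (Subring.sub_mem _ (Subring.mul_mem _ (algebraMap_mem_range p t) (algebraMap_mem_range p _))
      (Subring.mul_mem _ (algebraMap_mem_range p a) (algebraMap_mem_range p _)))

/-- Elements of `R` have `∂_b` of value `≤ 1`. [folklore] -/
theorem ordVK_pd_le_one_of_mem_range (b : Fin 3) {s : K p} (hs : s ∈ Rg p) : ordVK p (pd p b s) ≤ 1 :=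
  ordVK_range_le_one p ⟨_, pd_mem_range p b hs⟩

/-! ## 4. Injectivity of the gradient on `𝔪_R/𝔪_R²` -/

/-- A polynomial of value `< 1` has no constant term. [folklore] -/
theorem mem_origin_of_ordV_lt_one {a : Poly p} (h : ordV p a < 1) : a ∈ origin p := by
  by_contra hn
  rw [ordV_eq_one_of_not_mem p hn] at h
  exact lt_irrefl _ h

/-- **A polynomial without constant term all of whose partial derivatives have no constant term lies in `(X)²`.** [folklore] -/
theorem mem_origin_sq_of_pderiv {a : Poly p} (ha : a ∈ origin p) (hd : ∀ b, pderiv b a ∈ origin p) : a ∈ origin p ^ 2 := by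
  rw [origin_eq_idealOfVars, MvPolynomial.mem_pow_idealOfVars_iff]
  intro m hm
  by_contra hlt
  rw [not_le] at hlt
  have hcm : coeff m a ≠ 0 := mem_support_iff.mp hm
  by_cases hm0 : m = 0
  · subst hm0
    rw [RingHom.mem_ker, constantCoeff_eq] at ha
    exact hcm ha
  · -- `m = single b 1`
    obtain ⟨b, hb⟩ : ∃ b, m b ≠ 0 := by
      by_contra hcon
      push Not at hcon
      exact hm0 (Finsupp.ext hcon)
    have hle : Finsupp.single b 1 ≤ m := Finsupp.single_le_iff.mpr (Nat.one_le_iff_ne_zero.mpr hb)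
    have hsplit : m - Finsupp.single b 1 + Finsupp.single b 1 = m := tsub_add_cancel_of_le hle
    have hdeg : (m - Finsupp.single b 1).degree = 0 := by
      have := congrArg Finsupp.degree hsplit
      rw [map_add, Finsupp.degree_single] at this
      omega
    have hm' : m - Finsupp.single b 1 = 0 := (Finsupp.degree_eq_zero_iff _).mp hdeg
    have hm1 : m = Finsupp.single b 1 := by rw [← hsplit, hm', zero_add]
    have h0 : coeff 0 (pderiv b a) = 0 := by
      have := hd b
      rwa [RingHom.mem_ker, constantCoeff_eq] at this
    rw [coeff_pderiv, zero_add] at h0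
    simp only [Finsupp.coe_zero, Pi.zero_apply, Nat.cast_zero, zero_add, mul_one] at h0
    rw [← hm1] at h0
    exact hcm h0

/-- **Injectivity of the gradient**: `s ∈ 𝔪_R` with `ord (∂_b s) > 0` for all `b` lies in `𝔪_R²`. [folklore] -/
theorem mem_sq_of_ordVK_pd_lt_one {s : Rg p} (hs : s ∈ maximalIdeal (Rg p))
    (hd : ∀ b, ordVK p (pd p b (s : K p)) < 1) : s ∈ maximalIdeal (Rg p) ^ 2 := by
  obtain ⟨a, t, ht, ht0, hs'⟩ := exists_eq_div_of_mem_range p s.2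
  have hvt : ordVK p (algebraMap (Poly p) (K p) t) = 1 := by rw [ordVK_algebraMap, ordV_eq_one_of_not_mem p ht]
  have hva : ordVK p (s : K p) = ordV p a := by rw [hs', map_div₀, hvt, div_one, ordVK_algebraMap]
  have ha : a ∈ origin p := mem_origin_of_ordV_lt_one p (hva ▸ (mem_maximalIdeal_range_iff p s).mp hs)
  have hda : ∀ b, pderiv b a ∈ origin p := by
    intro b
    have h1 := hd b
    rw [hs', Derivation.leibniz_div, pd_algebraMap, pd_algebraMap] at h1
    simp only [smul_eq_mul, map_mul, map_pow, map_inv₀, hvt, inv_one, one_pow, one_mul] at h1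
    rw [← map_mul, ← map_mul, ← map_sub, ordVK_algebraMap] at h1
    have h2 : t * pderiv b a - a * pderiv b t ∈ origin p := mem_origin_of_ordV_lt_one p h1
    have h3 : t * pderiv b a ∈ origin p := by
      have := Ideal.add_mem _ h2 (Ideal.mul_mem_right (pderiv b t) _ ha)
      rwa [sub_add_cancel] at this
    exact ((origin_isMaximal p).isPrime.mem_or_mem h3).resolve_left ht
  have ha2 : a ∈ origin p ^ 2 := mem_origin_sq_of_pderiv p ha hda
  apply mem_pow_of_ordVK_le_expNeg
  rw [hva]
  by_cases ha0 : a = 0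
  · rw [ha0, map_zero]; exact zero_le
  exact (ordV_le_expNeg_iff p ha0 2).mpr ha2

/-! ## 5. Some Wronskian of two members of a regular system of parameters has order one -/

omit hp in
/-- Cancellation in `ℤᵐ⁰`: `exp(−m) · v ≤ exp(−(m+n)) ⟹ v ≤ exp(−n)`. [folklore] -/
theorem le_expNeg_of_mul_le {v : WithZero (Multiplicative ℤ)} {m n : ℕ} (h : expNeg m * v ≤ expNeg (m + n)) :
    v ≤ expNeg n := by
  rcases eq_or_ne v 0 with rfl | hv
  · exact zero_le
  obtain ⟨z, rfl⟩ := WithZero.ne_zero_iff_exists.mp hv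
  rw [expNeg, expNeg, ← WithZero.coe_mul, WithZero.coe_le_coe, ← Multiplicative.toAdd_le, toAdd_mul, toAdd_ofAdd,
    toAdd_ofAdd] at h
  rw [expNeg, WithZero.coe_le_coe, ← Multiplicative.toAdd_le, toAdd_ofAdd]
  push_cast at h ⊢
  omega

omit hp in
/-- Discreteness: `v < exp(−1) ⟹ v ≤ exp(−2)`. [folklore] -/
theorem le_expNeg_two_of_lt_expNeg_one {v : WithZero (Multiplicative ℤ)} (h : v < expNeg 1) : v ≤ expNeg 2 := by
  rcases eq_or_ne v 0 with rfl | hv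
  · exact zero_le
  obtain ⟨z, rfl⟩ := WithZero.ne_zero_iff_exists.mp hv
  rw [expNeg, WithZero.coe_lt_coe, ← Multiplicative.toAdd_lt, toAdd_ofAdd] at h
  rw [expNeg, WithZero.coe_le_coe, ← Multiplicative.toAdd_le, toAdd_ofAdd]
  push_cast at h ⊢
  omega

variable {p}
variable {x : Fin 3 → Rg p} (hx : Ideal.span (Set.range x) = maximalIdeal (Rg p))

include hx in
/-- Replacing `v` by `v − λu₀` in a regular system of parameters `(u₀, v, w)` gives one again; in particular `v − λu₀ ∉ 𝔪²`.
[folklore] -/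
theorem sub_mul_not_mem_sq (lam : Rg p) : x 1 - lam * x 0 ∉ maximalIdeal (Rg p) ^ 2 := by
  have hspan : Ideal.span (Set.range ![x 0, x 1 - lam * x 0, x 2]) = maximalIdeal (Rg p) := by
    have hr : ∀ a b c : Rg p, Set.range ![a, b, c] = {a, b, c} := fun a b c => by
      ext t
      simp only [Set.mem_range, Fin.exists_fin_succ, Matrix.cons_val_zero, Matrix.cons_val_succ,
        Set.mem_insert_iff, Set.mem_singleton_iff, eq_comm]
      simp
    have hr3 : Set.range x = {x 0, x 1, x 2} := by
      ext t
      simp only [Set.mem_range, Set.mem_insert_iff, Set.mem_singleton_iff]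
      constructor
      · rintro ⟨i, rfl⟩
        fin_cases i <;> simp
      · rintro (rfl | rfl | rfl) <;> exact ⟨_, rfl⟩
    rw [hr, ← hx, hr3]
    apply le_antisymm
    · rw [Ideal.span_le]
      rintro t (rfl | rfl | rfl)
      · exact Ideal.subset_span (Or.inl rfl)
      · exact Ideal.sub_mem _ (Ideal.subset_span (Or.inr (Or.inl rfl)))
          (Ideal.mul_mem_left _ _ (Ideal.subset_span (Or.inl rfl)))
      · exact Ideal.subset_span (Or.inr (Or.inr rfl))
    · rw [Ideal.span_le]
      rintro t (rfl | rfl | rfl)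
      · exact Ideal.subset_span (Or.inl rfl)
      · have h1 : x 1 - lam * x 0 ∈ Ideal.span ({x 0, x 1 - lam * x 0, x 2} : Set (Rg p)) :=
          Ideal.subset_span (Or.inr (Or.inl rfl))
        have h2 : lam * x 0 ∈ Ideal.span ({x 0, x 1 - lam * x 0, x 2} : Set (Rg p)) :=
          Ideal.mul_mem_left _ _ (Ideal.subset_span (Or.inl rfl))
        have h3 := Ideal.add_mem _ h1 h2
        rw [sub_add_cancel] at h3
        exact h3
      · exact Ideal.subset_span (Or.inr (Or.inr rfl))
  exact (isRsopPart_of_span_eq hspan).not_mem_sq 1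

include hx in
/-- **Some Wronskian `u₀ ∂_b v − v ∂_b u₀` has order exactly `1`.**  Otherwise all three lie in `𝔪²`; with `b₀` such that
`∂_{b₀} u₀` is a unit (it exists: `u₀ ∉ 𝔪²` and the gradient is injective) and `λ = ∂_{b₀} v / ∂_{b₀} u₀`, every `∂_b (v − λu₀)`
lies in `𝔪` (`u₀ · (∂_{b₀}u₀ ∂_b v − ∂_{b₀}v ∂_b u₀) ∈ 𝔪²` forces the bracket into `𝔪`), so `v − λu₀ ∈ 𝔪²` — absurd. [folklore] -/
theorem exists_ordVK_wronskian_eq :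
    ∃ b : Fin 3, ordVK p ((x 0 : K p) * pd p b (x 1 : K p) - (x 1 : K p) * pd p b (x 0 : K p)) = expNeg 1 := by
  have hRfix := locAtCentre_range_eq p
  have hx0 := ordVK_rsop hx 0
  have hx1 := ordVK_rsop hx 1
  -- the Wronskians lie in `R` and have order `≥ 1`
  set W : Fin 3 → K p := fun b => (x 0 : K p) * pd p b (x 1 : K p) - (x 1 : K p) * pd p b (x 0 : K p) with hW
  have hWmem : ∀ b, W b ∈ Rg p := fun b =>
    Subring.sub_mem _ (Subring.mul_mem _ (x 0).2 (pd_mem_range p b (x 1).2))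
      (Subring.mul_mem _ (x 1).2 (pd_mem_range p b (x 0).2))
  have hWle : ∀ b, ordVK p (W b) ≤ expNeg 1 := by
    intro b
    refine (Valuation.map_sub _ _ _).trans (max_le ?_ ?_)
    · rw [map_mul, hx0]
      calc expNeg 1 * ordVK p (pd p b (x 1 : K p)) ≤ expNeg 1 * 1 :=
            mul_le_mul' le_rfl (ordVK_pd_le_one_of_mem_range p b (x 1).2)
        _ = expNeg 1 := mul_one _
    · rw [map_mul, hx1]
      calc expNeg 1 * ordVK p (pd p b (x 0 : K p)) ≤ expNeg 1 * 1 :=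
            mul_le_mul' le_rfl (ordVK_pd_le_one_of_mem_range p b (x 0).2)
        _ = expNeg 1 := mul_one _
  by_contra hcon
  push Not at hcon
  have hW2 : ∀ b, ordVK p (W b) ≤ expNeg 2 := fun b =>
    le_expNeg_two_of_lt_expNeg_one (lt_of_le_of_ne (hWle b) (hcon b))
  -- `b₀` with `∂_{b₀} u₀` a unit
  obtain ⟨b₀, hb₀⟩ : ∃ b₀, ordVK p (pd p b₀ (x 0 : K p)) = 1 := by
    by_contra hnone
    push Not at hnone
    have hall : ∀ b, ordVK p (pd p b (x 0 : K p)) < 1 := fun b =>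
      lt_of_le_of_ne (ordVK_pd_le_one_of_mem_range p b (x 0).2) (hnone b)
    exact (isRsopPart_of_span_eq hx).not_mem_sq 0 (mem_sq_of_ordVK_pd_lt_one p (rsop_mem_maximalIdeal hx 0) hall)
  set d₀ : K p := pd p b₀ (x 0 : K p) with hd₀
  have hd₀0 : d₀ ≠ 0 := (Valuation.ne_zero_iff (ordVK p)).mp (by rw [hb₀]; exact one_ne_zero)
  have hd₀O : (O p).valuation d₀ = 1 := (Valuation.isEquiv_valuation_valuationSubring (ordVK p)).eq_one_iff_eq_one.mp hb₀
  have hd₀inv : d₀⁻¹ ∈ Rg p := by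
    have := inv_mem_locAtCentre (le_locAtCentre (Rg p) (O p) (pd_mem_range p b₀ (x 0).2)) hd₀O
    rwa [hRfix] at this
  -- `λ = ∂_{b₀} v / ∂_{b₀} u₀ ∈ R`
  set lamK : K p := pd p b₀ (x 1 : K p) * d₀⁻¹ with hlamK
  have hlam : lamK ∈ Rg p := Subring.mul_mem _ (pd_mem_range p b₀ (x 1).2) hd₀inv
  set lam : Rg p := ⟨lamK, hlam⟩
  -- `v − λu₀ ∈ 𝔪²` by injectivity of the gradient
  apply sub_mul_not_mem_sq hx lam
  refine mem_sq_of_ordVK_pd_lt_one p (Ideal.sub_mem _ (rsop_mem_maximalIdeal hx 1)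
    (Ideal.mul_mem_left _ _ (rsop_mem_maximalIdeal hx 0))) fun b => ?_
  -- `∂_b (v − λ u₀) = (∂_b v − λ ∂_b u₀) − u₀ ∂_b λ`
  have hderiv : pd p b (((x 1 - lam * x 0 : Rg p) : K p)) =
      (pd p b (x 1 : K p) - lamK * pd p b (x 0 : K p)) - (x 0 : K p) * pd p b lamK := by
    push_cast
    rw [map_sub, Derivation.leibniz, smul_eq_mul, smul_eq_mul]
    change pd p b (x 1 : K p) - (lamK * pd p b (x 0 : K p) + (x 0 : K p) * pd p b lamK) = _
    ring
  rw [hderiv]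
  refine lt_of_le_of_lt (Valuation.map_sub _ _ _) (max_lt ?_ ?_)
  · -- `μ = ∂_{b₀}u₀ ∂_b v − ∂_{b₀}v ∂_b u₀` has `u₀ μ ∈ 𝔪²`, hence `μ ∈ 𝔪`
    set μ : K p := d₀ * pd p b (x 1 : K p) - pd p b₀ (x 1 : K p) * pd p b (x 0 : K p) with hμ
    have hμeq : pd p b (x 1 : K p) - lamK * pd p b (x 0 : K p) = μ * d₀⁻¹ := by
      rw [hμ, hlamK]; field_simp
    have hx0μ : (x 0 : K p) * μ = d₀ * W b - pd p b (x 0 : K p) * W b₀ := by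
      simp only [hμ, hW, hd₀]; ring
    have hvx0μ : ordVK p ((x 0 : K p) * μ) ≤ expNeg 2 := by
      rw [hx0μ]
      refine (Valuation.map_sub _ _ _).trans (max_le ?_ ?_)
      · rw [map_mul, hb₀, one_mul]; exact hW2 b
      · rw [map_mul]
        calc ordVK p (pd p b (x 0 : K p)) * ordVK p (W b₀) ≤ 1 * expNeg 2 :=
              mul_le_mul' (ordVK_pd_le_one_of_mem_range p b (x 0).2) (hW2 b₀)
          _ = expNeg 2 := one_mul _
    rw [map_mul, hx0] at hvx0μ
    have hvμ : ordVK p μ ≤ expNeg 1 := le_expNeg_of_mul_le (m := 1) (n := 1) hvx0μ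
    rw [hμeq, map_mul, map_inv₀, hb₀, inv_one, mul_one]
    exact lt_of_le_of_lt hvμ (expNeg_lt_one_iff.mpr one_pos)
  · rw [map_mul, hx0]
    calc expNeg 1 * ordVK p (pd p b lamK) ≤ expNeg 1 * 1 := mul_le_mul' le_rfl (ordVK_pd_le_one_of_mem_range p b hlam)
      _ < 1 := by rw [mul_one]; exact expNeg_lt_one_iff.mpr one_pos

end OrdWitness

end Summit.ResolutionOfSingularities.ResolutionOfSingularities.Theorems.CleanModels.Negative

end
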